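import Summits.KontsevichZagierPeriods.KontsevichZagierPeriods.Theses.ValuedFieldSpecialisation
import Summits.KontsevichZagierPeriods.KontsevichZagierPeriods.Theorems.ValuedFieldSpecialisationParametricLiftingStrata
import Summits.KontsevichZagierPeriods.KontsevichZagierPeriods.Theses.LowDimension

/-!
# `ParametricLifting` (stmt-KontsevichZagierPeriods-3498, route ValuedFieldSpecialisation) — skeleton, line
# `registered`, RESHAPED TO THE LEVEL-WISE LOSSLESS SPLIT (lead c9, 2026-08-17)

Crux (verbatim the route decl `…Theses.ValuedFieldSpecialisation.ParametricLifting`): for rational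
representations `r`, `r'` with equal value there is `G` in the subgroup generated by the FIBRED moves whose
net expression is a `ℤ`-combination of DOMINATED families whose special fibres sum to `[r] − [r']` modulo
`KZ.relations`.

## History of the line (one line each; details in `Cruxes/ParametricLifting/LEAD-REPORT-c*.md`)

* birth (planner) / c1 reshape: S1 regularised lifting + S2 divergent net vanishes (LANDED) + S3 resonance removal
  (S3b ⟺ `KZKernelConjecture`) — composition CIRCULAR, line dead (c1, c2); c3–c6: kernel form, cylinders,
  tightness of every clause, the Frullani sector instance (all landed `--supports`).
* c7 RESHAPE by DIMENSION GRADING: RLG(`E`) (graded regularised lifting) + SF (special-fibre rigidity ⟸ sibling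
  crux CTConstruction, stmt-3495); composition = induction on the level, a TREE THEOREM (p165479).
* c8: the rungs of RLG are the dimension strata of the summit (p168377): level `2` ⟺ `PlanarAreas` (stmt-4990),
  level `d+1` ⟺ volume conjecture in `ℝ^{d+1}`; stubs R2 = 4990 verbatim, R3 = RLG on levels `≥ 3`, SF.
* **c9 (this file): the LEVEL-WISE LOSSLESS SPLIT.** Grade SF by fibre dimension — SFG(`E`): the dominated
  families have fibres of dimension `< E` — and RLG by the fibre dimension of its dominated net — RLG′(`E`): the
  net certifying a level-`E` element lives on level `E`. Tree theorems (all ACCEPTED `--supports`): KL(`E`) ⇒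
  SFG(`E`) (p172334) and ⇒ RLG′(`E`) (p172255); SFG(`1`) unconditional (p172357); `PlanarAreas` ⇒ SFG(`2`)
  (p172358); SFG(`2`) for RATIONAL special fibres unconditional (p172365, Baker); the graded step KL(`E`) →
  RLG′(`E+1`) → SFG(`E+1`) → KL(`E+1`) (p172325). Hence over KL(`E`): **KL(`E+1`) ⇔ RLG′(`E+1`) ∧ SFG(`E+1`)** —
  at every level the pair (regularised lifting, special-fibre rigidity) is EXACTLY that level's kernel conjecture
  (⇔ the volume conjecture in `ℝ^{E+1}`), and levels `≤ 2` of BOTH sides are item 4990 alone: the c8 composition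
  spent SF at fibre dimensions `0` and `1` idly, and let the dominated net live in any dimension. The stubs become

  * **R2 `stub_planarAreas` — VERBATIM the shared item stmt-KontsevichZagierPeriods-4990** (unchanged; a worker
    reports `stub-blocked: stmt-KontsevichZagierPeriods-4990`);
  * **R3′ `stub_regLiftGradedLevel_ge_three` — THE OPEN CORE, existence half: RLG′ on levels `E ≥ 3`**
    (regularised family proofs of the identities among periods of dimension `≥ 2`, the certifying dominated net on
    the level; implied level by level by the volume conjecture in `ℝ^E`; `ζ(2)`, dilogarithms, products of
    1-periods, Legendre's relation with its level-2 divergent coefficients; then MZVs …) [difficulty: open-problem];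
  * **SF′ `stub_specialFibreGraded_ge_three` — the conservativity half on levels `E ≥ 3` only**: special fibres
    of dominated fibred relations with fibres of dimension `< E` are relations (⟸ `CTConstruction` stmt-3495 via
    `specialFibre_of_ctConstruction`; ⟸ KL(`E`); a worker reports `stub-blocked: stmt-KontsevichZagierPeriods-3495`).

Composition (real proofs below, INLINED so that the skeleton elaborates on farm nodes that have not yet built
today's modules; they are verbatim the landed `stub_kernelLevel_succ_of_graded` p172325 and the Split file):
KL(`≤ 2`) from R2 (`kernelLevelTwo_iff_planarAreas`, p168377, and monotonicity of levels); KL(`E`) → KL(`E+1`)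
for `E + 1 ≥ 3` by the graded step fed with R3′(`E+1`), SF′(`E+1`); every `x` lies on some level
(`stub_exists_dimBound`, p164935) ⇒ `KZKernelConjecture` ⇒ `ParametricLifting` (`G := 0`,
`parametricLifting_of_kzKernelConjecture`) — `ParametricLifting_of` concludes the crux BY NAME.
Strength bookkeeping (tree theorem `stub_kontsevichZagierPeriods_iff_planarAreas_and_graded_ge_three`, Split
file): summit ⇔ R2 ∧ R3′ ∧ SF′ (lossless), each stub summit-implied, none known summit-equivalent alone.

Disproof used: none — `ledger crux ls stmt-KontsevichZagierPeriods-3498` lists no `Disproof.lean` and no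
`Theorems/ParametricLifting/Negative/*` (2026-08-17T19:3xZ). Barriers: the strength barriers
`kzConjecture_implies_*` are engaged by R3′ and SF′ exactly as by the crux (declared open core, not evaded);
R2 engages them only through 1-periods (Baker / Wüstholz, the one place where the transcendence theory is in
print); the composition is transcendence-free.
-/

noncomputable section

-- `Summit.KontsevichZagierPeriods.KontsevichZagierPeriods.…` is the tree's mandated layout (single-conjunct summit).
set_option linter.dupNamespace false

namespace Summit.KontsevichZagierPeriods.KontsevichZagierPeriods.Cruxes.ParametricLifting.Birth

open scoped BigOperators Topology
open MeasureTheory Set Filter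
open Literature.NumberTheory.Transcendental
open Summit.KontsevichZagierPeriods.KontsevichZagierPeriods.Theses.ValuedFieldSpecialisation (ParametricLifting)
open Summit.KontsevichZagierPeriods.ValuedFieldSpecialisation
  (parametricLifting_of_kzKernelConjecture kernelLevelTwo_iff_planarAreas stub_exists_dimBound
    stub_divergentNetVanishes_of stub_sliceValue_elementaryFamily stub_divergentMonomials_coeff_eq_zero
    stub_eval_coefficientClass_eq_zero stub_elementaryNet_mem_fibredRelations)
open Summit.KontsevichZagierPeriods.KontsevichZagierPeriods.Theses.LowDimension (PlanarAreas)

/-! ### The three registered stubs -/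

/-- **Stub R2 — rung 2 = `PlanarAreas` (stmt-KontsevichZagierPeriods-4990, verbatim).** Two two-dimensional
representations with integrand `1` — two `ℚ`-semialgebraic planar sets of finite area — with the same area are
KZ-equivalent. Equivalent to Kontsevich–Zagier's Conjecture 1 for all pairs of representations of dimension `≤ 1`
(real 1-periods); it carries levels `≤ 2` of BOTH halves of this crux (`kernelLevel_le_two_of_planarAreas'`,
SFG(`≤2`) p172358, RLG′(`≤2`) p172255); its rational-integrand part is a theorem (Baker; p168377, p172365); the
printed transcendence input for the rest is Huber–Wüstholz 2022, Thm. 13.3, whose transfer into the four moves is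
the open content (routes LowDimension 4990, SymplecticScissors 10042, DessinsDimensionOne 6261, AbelContraction
12475). A worker reports `stub-blocked: stmt-KontsevichZagierPeriods-4990`. [cite: HuberWustholz2022, Thm. 13.3] -/
theorem stub_planarAreas :
    ∀ (r r' : KZ.IntegralRep 2), (∀ p ∈ r.domain, r.integrand p = 1) → (∀ p ∈ r'.domain, r'.integrand p = 1) → r.value = r'.value → KZ.Equivalent r r' := by
  sorry

/-- **Stub R3′ — THE OPEN CORE, existence half: the fibre-graded regularised lifting on levels `E ≥ 3`.** For
every level `E ≥ 3` and every formal combination `x` of representations of dimension `< E` with `KZ.eval x = 0`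
there is a fibred relation `H = D + N`, `D` elementary divergent with coefficient representations of dimension
`dᵢ`, `dᵢ + 1 < E`, `N` a net of DOMINATED families with fibres of dimension `d₂ j < E` and special-fibre class
`≡ x`. Implied by KL(`E`) (empty net, p172255), hence by the summit and, level by level, by the volume conjecture
in `ℝ^E`; of Conjecture-1 strength from level `3` on. [difficulty: open-problem]
[cite: KontsevichZagier2001, §1.2 Conjecture 1] -/
theorem stub_regLiftGradedLevel_ge_three : ∀ (E : ℕ), 3 ≤ E → (∀ (x : KZ.FormalRep), x ∈ AddSubgroup.closure {y : KZ.FormalRep | ∃ (n : ℕ) (r : KZ.IntegralRep n), n < E ∧ y = KZ.of r} → KZ.eval x = 0 → ∃ H ∈ KZ.fibredRelations, ∃ (k : ℕ) (m : Fin k → ℤ) (p q b d : Fin k → ℕ) (ρ : (i : Fin k) → KZ.IntegralRep (d i)) (P : (i : Fin k) → KZ.IntegralRep (b i + d i + 1 + 1)) (k₂ : ℕ) (d₂ : Fin k₂ → ℕ) (m₂ : Fin k₂ → ℤ) (R : (j : Fin k₂) → KZ.IntegralRep (d₂ j + 1)) (r₀ g : (j : Fin k₂) → KZ.IntegralRep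 (d₂ j)), (∀ i, 0 < q i ∧ p i < q i ∧ (0 < p i ∨ 0 < b i) ∧ d i + 1 < E ∧ (P i).domain = {z | ∃ (s u : ℝ) (y : Fin (b i) → ℝ) (w : Fin (d i) → ℝ), z = Matrix.vecCons s (Matrix.vecCons u (Fin.append y w)) ∧ 0 < s ∧ s < 1 ∧ 0 < u ∧ u ^ (q i) * s ^ (p i) < 1 ∧ (∀ j, s ≤ y j ∧ y j ≤ 1) ∧ w ∈ (ρ i).domain} ∧ (P i).integrand = fun z => (∏ j : Fin (b i), (z (Fin.castAdd (d i) j).succ.succ)⁻¹) * (ρ i).integrand (fun l : Fin (d i) => z (Fin.natAdd (b i) l).succ.succ)) ∧ (∀ j, d₂ j < E ∧ KZ.IsDominatedFamily (R j) (r₀ j) (g j)) ∧ H = (∑ i, m i • KZ.of (P i)) + (∑ j, m₂ j • KZ.of (R j)) ∧ (∑ j, m₂ j • KZ.of (r₀ j)) - x ∈ KZ.relations) := by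
  sorry

/-- **Stub SF′ — the conservativity half on levels `E ≥ 3`: graded special-fibre rigidity.** If
`Σ mᵢ [Rᵢ] ∈ KZ.fibredRelations`, every `Rᵢ` is dominated near `s = 0⁺` with special fibre `r₀ᵢ`, and the fibres
have dimension `dᵢ < E`, then `Σ mᵢ [r₀ᵢ] ∈ KZ.relations`. The value shadow is a theorem
(`eval_specialFibre_eq_zero`); the class statement is implied by KL(`E`) (p172334) and is what the sibling crux
`CTConstruction` (stmt-KontsevichZagierPeriods-3495, open) delivers in every dimension
(`specialFibre_of_ctConstruction`); levels `≤ 2` need neither (p172357, p172358). A worker reports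
`stub-blocked: stmt-KontsevichZagierPeriods-3495`. [cite: KontsevichZagier2001, §1.2] -/
theorem stub_specialFibreGraded_ge_three : ∀ (E : ℕ), 3 ≤ E → ∀ (k : ℕ) (d : Fin k → ℕ) (m : Fin k → ℤ) (R : (i : Fin k) → KZ.IntegralRep (d i + 1)) (r₀ g : (i : Fin k) → KZ.IntegralRep (d i)), (∀ i, d i < E) → (∀ i, KZ.IsDominatedFamily (R i) (r₀ i) (g i)) → (∑ i, m i • KZ.of (R i)) ∈ KZ.fibredRelations → (∑ i, m i • KZ.of (r₀ i)) ∈ KZ.relations := by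
  sorry

/-! ### Levels `≤ 2` from R2 (real proofs; = the Split file, inlined) -/

/-- **R2 ⇒ the kernel conjecture on every level `E ≤ 2`**: level `E ≤ 2` is contained in level `2`
(`AddSubgroup.closure_mono`) and KL(`2`) ⇔ `PlanarAreas` (`kernelLevelTwo_iff_planarAreas`, p168377).
[cite: HuberWustholz2022, Thm. 13.3] -/
theorem kernelLevel_le_two_of_planarAreas' (h : PlanarAreas) :
    ∀ (E : ℕ), E ≤ 2 → (∀ (x : KZ.FormalRep), x ∈ AddSubgroup.closure {y : KZ.FormalRep | ∃ (n : ℕ) (r : KZ.IntegralRep n), n < E ∧ y = KZ.of r} → KZ.eval x = 0 → x ∈ KZ.relations) := by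
  intro E hE x hx hx0
  refine kernelLevelTwo_iff_planarAreas.mpr h x (AddSubgroup.closure_mono ?_ hx) hx0
  rintro _ ⟨n, r, hn, rfl⟩
  exact ⟨n, r, by omega, rfl⟩

/-! ### The graded induction step (real proof; = `stub_kernelLevel_succ_of_graded`, p172325, inlined) -/

/-- **KL(`E`) → RLG′(`E+1`) → SFG(`E+1`) → KL(`E+1`)**: the slices of the elementary divergent part of the
certifying net vanish (`stub_divergentNetVanishes_of`), its coefficient classes have value `0`
(`stub_eval_coefficientClass_eq_zero`) on level `E` and so are relations by KL(`E`), the divergent part is a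
fibred relation (`stub_elementaryNet_mem_fibredRelations`), hence so is the dominated net `H − D`, whose fibres
have dimension `< E + 1`, and the graded rigidity makes its special fibre, `≡ x`, a relation.
[cite: KontsevichZagier2001, §1.2 Conjecture 1] -/
theorem kernelLevel_succ_of_graded' : ∀ (E : ℕ), (∀ (x : KZ.FormalRep), x ∈ AddSubgroup.closure {y : KZ.FormalRep | ∃ (n : ℕ) (r : KZ.IntegralRep n), n < E ∧ y = KZ.of r} → KZ.eval x = 0 → x ∈ KZ.relations) → (∀ (x : KZ.FormalRep), x ∈ AddSubgroup.closure {y : KZ.FormalRep | ∃ (n : ℕ) (r : KZ.IntegralRep n), n < E + 1 ∧ y = KZ.of r} → KZ.eval x = 0 → ∃ H ∈ KZ.fibredRelations, ∃ (k : ℕ) (m : Fin k → ℤ) (p q b d : Fin k → ℕ) (ρ : (i : Fin k) → KZ.IntegralRep (d i)) (P : (i : Fin k) → KZ.IntegralRep (b i + d i + 1 + 1)) (k₂ : ℕ) (d₂ : Fin k₂ → ℕ) (m₂ : Fin k₂ → ℤ) (R : (j : Fin k₂) → KZ.IntegralRep (d₂ j + 1)) (r₀ g : (j : Fin k₂) →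 KZ.IntegralRep (d₂ j)), (∀ i, 0 < q i ∧ p i < q i ∧ (0 < p i ∨ 0 < b i) ∧ d i + 1 < E + 1 ∧ (P i).domain = {z | ∃ (s u : ℝ) (y : Fin (b i) → ℝ) (w : Fin (d i) → ℝ), z = Matrix.vecCons s (Matrix.vecCons u (Fin.append y w)) ∧ 0 < s ∧ s < 1 ∧ 0 < u ∧ u ^ (q i) * s ^ (p i) < 1 ∧ (∀ j, s ≤ y j ∧ y j ≤ 1) ∧ w ∈ (ρ i).domain} ∧ (P i).integrand = fun z => (∏ j : Fin (b i), (z (Fin.castAdd (d i) j).succ.succ)⁻¹) * (ρ i).integrand (fun l : Fin (d i) => z (Fin.natAdd (b i) l).succ.succ)) ∧ (∀ j, d₂ j < E + 1 ∧ KZ.IsDominatedFamily (R j) (r₀ j) (g j)) ∧ H = (∑ i, m i • KZ.of (P i)) + (∑ j, m₂ j • KZ.of (R j)) ∧ (∑ j, m₂ j • KZ.of (r₀ j)) - x ∈ KZ.relations) → (∀ (k : ℕ) (d : Fin k → ℕ) (m : Fin k → ℤ) (R : (i : Fin k) → KZ.IntegralRep (d i + 1)) (r₀ g : (i : Fin k)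 → KZ.IntegralRep (d i)), (∀ i, d i < E + 1) → (∀ i, KZ.IsDominatedFamily (R i) (r₀ i) (g i)) → (∑ i, m i • KZ.of (R i)) ∈ KZ.fibredRelations → (∑ i, m i • KZ.of (r₀ i)) ∈ KZ.relations) → (∀ (x : KZ.FormalRep), x ∈ AddSubgroup.closure {y : KZ.FormalRep | ∃ (n : ℕ) (r : KZ.IntegralRep n), n < E + 1 ∧ y = KZ.of r} → KZ.eval x = 0 → x ∈ KZ.relations) := by
  intro E ih hRL hSF x hx hx0
  obtain ⟨H, hH, k, m, p, q, b, d, ρ, P, k₂, d₂, m₂, R, r₀, g, hP, hR, hHeq, hfib⟩ := hRL x hx hx0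
  have hP' : ∀ i, 0 < q i ∧ p i < q i ∧ (0 < p i ∨ 0 < b i) ∧ (P i).domain = {z | ∃ (s u : ℝ) (y : Fin (b i) → ℝ) (w : Fin (d i) → ℝ), z = Matrix.vecCons s (Matrix.vecCons u (Fin.append y w)) ∧ 0 < s ∧ s < 1 ∧ 0 < u ∧ u ^ (q i) * s ^ (p i) < 1 ∧ (∀ j, s ≤ y j ∧ y j ≤ 1) ∧ w ∈ (ρ i).domain} ∧ (P i).integrand = fun z => (∏ j : Fin (b i), (z (Fin.castAdd (d i) j).succ.succ)⁻¹) * (ρ i).integrand (fun l : Fin (d i) => z (Fin.natAdd (b i) l).succ.succ) :=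
    fun i => ⟨(hP i).1, (hP i).2.1, (hP i).2.2.1, (hP i).2.2.2.2⟩
  have hvan : ∀ s ∈ Set.Ioo (0 : ℝ) 1, KZ.sliceEval (∑ i, m i • KZ.of (P i)) s = 0 :=
    stub_divergentNetVanishes_of stub_sliceValue_elementaryFamily stub_divergentMonomials_coeff_eq_zero
      H hH k m p q b d ρ P k₂ d₂ m₂ R r₀ g (fun i => ⟨(hP i).1, (hP i).2.2.1, (hP i).2.2.2.2⟩)
      (fun j => (hR j).2) hHeq
  have hcoef : ∀ i₀ : Fin k, (∑ i ∈ Finset.univ.filter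
      (fun i => (p i / q i : ℝ) = (p i₀ / q i₀ : ℝ) ∧ b i = b i₀), m i • KZ.of (ρ i)) ∈ KZ.relations := by
    intro i₀
    refine ih _ ?_ (stub_eval_coefficientClass_eq_zero k m p q b d ρ P hP' hvan i₀)
    refine AddSubgroup.sum_mem _ fun i _ => AddSubgroup.zsmul_mem _ (AddSubgroup.subset_closure ?_) _
    exact ⟨d i, ρ i, by have := (hP i).2.2.2.1; omega, rfl⟩
  have hD : (∑ i, m i • KZ.of (P i)) ∈ KZ.fibredRelations :=
    stub_elementaryNet_mem_fibredRelations k m p q b d ρ P hP' hcoef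
  have hN : (∑ j, m₂ j • KZ.of (R j)) ∈ KZ.fibredRelations := by
    have hEq : (∑ j, m₂ j • KZ.of (R j)) = H - ∑ i, m i • KZ.of (P i) := by
      rw [hHeq]; abel
    rw [hEq]
    exact KZ.fibredRelations.sub_mem hH hD
  have h := KZ.relations.sub_mem (hSF k₂ d₂ m₂ R r₀ g (fun j => (hR j).1) (fun j => (hR j).2) hN) hfib
  rwa [sub_sub_cancel] at h

/-! ### The composition (real proofs) -/

/-- **The kernel conjecture on EVERY level from R2, R3′ and SF′**: levels `≤ 2` by
`kernelLevel_le_two_of_planarAreas'`; the step `E → E + 1` for `E + 1 ≥ 3` by `kernelLevel_succ_of_graded'` fed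
with R3′(`E+1`) and SF′(`E+1`). [cite: KontsevichZagier2001, §1.2 Conjecture 1] -/
theorem kernelLevel_all : ∀ (E : ℕ), (∀ (x : KZ.FormalRep), x ∈ AddSubgroup.closure {y : KZ.FormalRep | ∃ (n : ℕ) (r : KZ.IntegralRep n), n < E ∧ y = KZ.of r} → KZ.eval x = 0 → x ∈ KZ.relations) := by
  intro E
  induction E with
  | zero => exact kernelLevel_le_two_of_planarAreas' stub_planarAreas 0 (by omega)
  | succ E ih =>
    rcases Nat.lt_or_ge (E + 1) 3 with hE | hE
    · exact kernelLevel_le_two_of_planarAreas' stub_planarAreas (E + 1) (by omega)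
    · exact kernelLevel_succ_of_graded' E ih (stub_regLiftGradedLevel_ge_three (E + 1) hE)
        (stub_specialFibreGraded_ge_three (E + 1) hE)

/-- **The crux from the registered stubs, BY NAME**: every formal combination lies on some level
(`stub_exists_dimBound`, p164935), so `kernelLevel_all` is `KZKernelConjecture`, which gives `ParametricLifting`
through the summit with `G := 0` (`parametricLifting_of_kzKernelConjecture`, p152021).
[cite: KontsevichZagier2001, §1.2 Conjecture 1] -/
theorem ParametricLifting_of : ParametricLifting := by
  refine parametricLifting_of_kzKernelConjecture fun x hx => ?_
  obtain ⟨E, hE⟩ := stub_exists_dimBound x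
  exact kernelLevel_all E x hE hx

end Summit.KontsevichZagierPeriods.KontsevichZagierPeriods.Cruxes.ParametricLifting.Birth
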